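import Mathlib
import Literature.AlgebraicGeometry.Resolution.ProjectiveModelsCentresLocal
import HarnessLib

/-!
# Route `RadicialJung`, crux `CleanModels` (stmt-ResolutionOfSingularities-15917), line `Sketch` rev 14:
# definitions for ZARISKI PATCHING OF CLEAN PAIRS (the dim-3 slice, plan P2)

Helper (definitions + their trivial API only) for the registered stubs of `Cruxes/CleanModels/Lines/Sketch.lean`
rev 14, which cut the former stub `stub_cleanPatching3` («patching for clean pairs in dimension 3», not in print
as such) along the converged stub plans of res-B-lens-1 g2 (`Cruxes/DescentPerfectToAll/STRATEGY-CENSUS-4-addendum-A.md`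
§3) and res-B-lens-5 g2 (`Cruxes/DescentPerfectToAll/STUBPLAN-cleanPatching3-piltant-lens5.md` §4): Zariski's Patching
Theorem in the axiomatic form of Piltant 2013 (RACSAM 107, Thm. 2.4 / Prop. 5.1 / Cor. 5.7) for the regularity property
`P_clean(g₀)` := «the local ring is regular AND some non-trivial representative of the `K^p`-line of `g₀` is loosely clean
there», transferred from the tree's PROVED `P_reg` patching chain (`ProjectiveModels.lean` … `BadCurveInduction.lean`,
`RegLe ↦ CleanRegLe`).  The predicates are stated for a local ring `R` read in a field `F` through a ring map `f : R → F`
(so that ONE definition serves the three currencies of the line: subrings of `K` — `locAtCentre A O`,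
`ProjModel.stalkSubring M x` —, and stalks of schemes read in their function field):

* `LooseCleanForm p f G` — `G ∈ F` has one of the three LOOSE CLEAN FORMS at `R` (verbatim the disjunction of the
  registered stubs `stub_cleanLU3_of_frame` / `stub_cleanPatching3` of Sketch rev 13: unit × monomial in part of a
  regular system of parameters with all shown exponents prime to `p`; unit whose residue is not a `p`-th power;
  `s` with `s - c^p ∈ 𝔪 ∖ 𝔪²`).
* `CleanRegAt p f g₀` — `P_clean(g₀)` at `R`: `R` is a regular local ring and some non-trivial representative
  `∑ c_j^p g₀^j` (`c_j ≠ 0` for some `j ≠ 0`) of the `F^p`-line of `g₀` has a loose clean form at `R`.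
* `ModelCleanRegAt p g₀ M x`, `ModelCleanRegCentre p g₀ M v`, `ModelCleanRegLe p g₀ φ` — the same on the points /
  valuation centres of a projective model `M : ProjModel k K` (through `M.stalkSubring x ⊆ K`) and the conclusion shape
  `φ⁻¹(CleanReg M) ⊆ CleanReg N` of the patching theorem (the `P_clean` twins of `ProjModel.RegCentre`,
  `ProjModel.Hom.RegLe` of `ProjectiveModels.lean`).
* API: `ModelCleanRegLe.comp`, `ModelCleanRegLe.id`, `ModelCleanRegCentre.of_hom`, `modelCleanRegAt_of_stalkSubring_eq`
  (invariance under local isomorphisms = equality of the local rings inside `K`), `CleanRegAt.isRegularLocalRing`.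

Honest framing: definitions only; nothing here proves resolution in characteristic `p` or any case of `CleanModels`.
-/

noncomputable section

set_option linter.dupNamespace false -- mandated namespace of this single-conjunct summit

open CategoryTheory AlgebraicGeometry IsLocalRing
open Literature.AlgebraicGeometry.Resolution

namespace Summit.ResolutionOfSingularities.ResolutionOfSingularities.Theorems.RadicialJung.CleanModels

/-! ## Loose clean forms and the property `P_clean` -/

/-- **The three loose clean forms** of `G ∈ F` at the local ring `R`, read through `f : R → F`: (1) `G = f (u ∏ tᵢ^{aᵢ})`
with `u` a unit, `t₁, …, t_d` a regular system of parameters of `R` (`d = dim R`), `0 < m ≤ d` and `p ∤ aᵢ` for the shown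
exponents; (2) `G = f u`, `u` a unit with `u - c^p ∉ 𝔪` for every `c` (its residue is not a `p`-th power); (3) `G = f s`
with `s - c^p ∈ 𝔪 ∖ 𝔪²` for some `c`. [cite: CossartPiltant2019, Def. 2.4 and Prop. 2.22] -/
def LooseCleanForm (p : ℕ) {R F : Type*} [CommRing R] [IsLocalRing R] [CommRing F] (f : R →+* F) (G : F) : Prop :=
  (∃ (d m : ℕ) (hmd : m ≤ d) (t : Fin d → R) (a : Fin m → ℕ) (u : R), IsUnit u ∧
      Ideal.span (Set.range t) = maximalIdeal R ∧ ringKrullDim R = (d : WithBot ℕ∞) ∧ 0 < m ∧ (∀ i, ¬ p ∣ a i) ∧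
      G = f (u * ∏ i : Fin m, t (Fin.castLE hmd i) ^ (a i))) ∨
  (∃ u : R, IsUnit u ∧ G = f u ∧ ∀ c : R, u - c ^ p ∉ maximalIdeal R) ∨
  (∃ s c : R, G = f s ∧ s - c ^ p ∈ maximalIdeal R ∧ s - c ^ p ∉ maximalIdeal R ^ 2)

/-- **`P_clean(g₀)` at `R`** (Piltant 2013, Def. 2.1, for the regularity property of this line): `R` is a regular local
ring and some NON-TRIVIAL representative `∑ⱼ cⱼ^p g₀^j` (`cⱼ ≠ 0` for some `j ≠ 0`) of the `F^p`-line of `g₀` has a loose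
clean form at `R`. [cite: Piltant2013, Def. 2.1] -/
def CleanRegAt (p : ℕ) {R F : Type*} [CommRing R] [CommRing F] (f : R →+* F) (g₀ : F) : Prop :=
  ∃ (_ : IsRegularLocalRing R) (c : Fin p → F), (∃ j : Fin p, (j : ℕ) ≠ 0 ∧ c j ≠ 0) ∧
    LooseCleanForm p f (∑ j : Fin p, c j ^ p * g₀ ^ (j : ℕ))

/-- A clean-regular local ring is regular. [folklore] -/
theorem CleanRegAt.isRegularLocalRing {p : ℕ} {R F : Type*} [CommRing R] [CommRing F] {f : R →+* F} {g₀ : F}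
    (h : CleanRegAt p f g₀) : IsRegularLocalRing R :=
  h.1

/-! ## On projective models -/

section Models

variable {k K : Type} [Field k] [Field K] [Algebra k K]

/-- **`x ∈ M` is a clean-regular point** of the projective model `M` of `K/k` for the `K^p`-line of `g₀`: `P_clean(g₀)`
holds at the local ring `𝒪_{M,x} ⊆ K` (`ProjModel.stalkSubring`). [cite: Piltant2013, Def. 2.1 (`Reg_P(X)`)] -/
def ModelCleanRegAt (p : ℕ) (g₀ : K) (M : ProjModel k K) (x : M.X) : Prop :=
  CleanRegAt p (M.stalkSubring x).subtype g₀

/-- **`v` has a clean-regular centre on `M`** (the `P_clean` twin of `ProjModel.RegCentre`; Piltant 2013, Axiom 5: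
`x_V ∈ Reg_P(X)`). [cite: Piltant2013, §2 Axiom 5] -/
def ModelCleanRegCentre (p : ℕ) (g₀ : K) (M : ProjModel k K) (v : ZariskiRiemannSpace k K) : Prop :=
  ModelCleanRegAt p g₀ M (M.centre v)

/-- **`φ⁻¹(CleanReg M) ⊆ CleanReg N`** for a morphism of projective models `φ : N → M` (the `P_clean` twin of
`ProjModel.Hom.RegLe`; the conclusion shape `πᵢ⁻¹(Reg_P Xᵢ) ⊆ Reg_P(Y)` of Piltant 2013, Prop. 5.1).
[cite: Piltant2013, Prop. 5.1] -/
def ModelCleanRegLe (p : ℕ) (g₀ : K) {N M : ProjModel k K} (φ : N.Hom M) : Prop :=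
  ∀ y : N.X, ModelCleanRegAt p g₀ M (φ.f y) → ModelCleanRegAt p g₀ N y

variable {p : ℕ} {g₀ : K}

/-- Clean-regularity of a point only depends on its local ring inside `K` (so it is invariant under local isomorphisms
of models, `ProjModel.stalkSubring_eq_of_isIso_stalkMap`). [folklore] -/
theorem modelCleanRegAt_of_stalkSubring_eq {N M : ProjModel k K} {x : M.X} {y : N.X}
    (h : M.stalkSubring x = N.stalkSubring y) (hx : ModelCleanRegAt p g₀ M x) : ModelCleanRegAt p g₀ N y := by
  unfold ModelCleanRegAt at hx ⊢
  rw [← h]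
  exact hx

/-- The identity is clean-regularity preserving. [folklore] -/
theorem ModelCleanRegLe.id (M : ProjModel k K) :
    ModelCleanRegLe p g₀ (⟨𝟙 M.X, Category.id_comp _, Category.comp_id _⟩ : M.Hom M) :=
  fun _ h => h

/-- `ModelCleanRegLe` is stable under composition. [folklore] -/
theorem ModelCleanRegLe.comp {L N M : ProjModel k K} {ψ : L.Hom N} {φ : N.Hom M}
    (hψ : ModelCleanRegLe p g₀ ψ) (hφ : ModelCleanRegLe p g₀ φ) : ModelCleanRegLe p g₀ (ψ.comp φ) :=
  fun y h => hψ y (hφ (ψ.f y) (by rwa [ProjModel.Hom.comp_f, Scheme.Hom.comp_apply] at h))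

/-- Clean-regular centres lift along morphisms with `φ⁻¹(CleanReg M) ⊆ CleanReg N` (the `P_clean` twin of
`ProjModel.RegCentre.of_hom`). [folklore] -/
theorem ModelCleanRegCentre.of_hom {N M : ProjModel k K} (φ : N.Hom M) (hφ : ModelCleanRegLe p g₀ φ)
    {v : ZariskiRiemannSpace k K} (h : ModelCleanRegCentre p g₀ M v) : ModelCleanRegCentre p g₀ N v := by
  apply hφ
  rw [φ.map_centre v]
  exact h

/-- A model all of whose relevant centres are clean-regular is clean-regular at every point over which some valuation
of the given family is centred: pointwise form used by the patching glue (every point of an integral model is a centre,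
`KModel.exists_isCentre_of_isGenericPoint`). [folklore] -/
theorem modelCleanRegAt_of_isCentre {M : ProjModel k K} {v : ZariskiRiemannSpace k K} {x : M.X}
    (hx : M.IsCentre v x) (h : ModelCleanRegCentre p g₀ M v) : ModelCleanRegAt p g₀ M x := by
  rw [ProjModel.eq_centre_of_isCentre hx]
  exact h

end Models

end Summit.ResolutionOfSingularities.ResolutionOfSingularities.Theorems.RadicialJung.CleanModels

end
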